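/-
Copyright (c) 2026. All rights reserved.
Released under Apache 2.0 license as described in the file LICENSE.
Authors: abc-iut cell, statement-typer seat abc-iut-L4-t3 (wave 1; gen 6), over the model settings of abc-iut-w4-d095.
-/
import Literature.AnabelianGeometry.AbsoluteAnabelian.LogFrobeniusIotaOver
import Literature.AnabelianGeometry.AbsoluteAnabelian.LogFrobeniusMonoGenuineModel
import HarnessLib

/-!
# [AbsTopIII] Definition 5.4 (vii): the `ι⊞_{v,ε}` lie over `Th•[Z]` AT THE SETTINGS WITH GENUINE COMPONENTS (instances of the add-on `IotaOver`)

S. Mochizuki, *Topics in absolute anabelian geometry III: global reconstruction algorithms*,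
J. Math. Sci. Univ. Tokyo 22 (2015) 939–1156 [MochizukiAbsTopIII2015]; locators `p.N` = pages of the author's
manuscript (`paper:url-5493eb38cbb7`), read on the page (own render): Def 5.4 (iv) p. 127 l. 56–65 (the `λ⊞_{v,ν}`,
`λ_{v,ν}` "lie over `Th•[Z]`"), (v) p. 127 (the archimedean graph `k~ →(id) k~ ↠ k^× ↪ k`), (vii) p. 128 l. 83–101 (the
`ι⊞_{v,ε}`, "determined by the arrow in the diagram of (iii) (respectively, (v))").

PROOF-ONLY (no `def`; nothing restated).  The interface add-on `LogFrobeniusSetting.IotaOver` (this seat,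
`LogFrobeniusIotaOver.lean`: `ι⊞_{v,ε} ▹ (𝒩⊞_v → 𝒩_v → Th•[Z]) = (λ∘Λ lies over) ≫ (λ lies over)⁻¹`) HOLDS at the three §5
settings of the tree with genuine components, all by abc-iut-w4-d095:

* `archGenuine_iotaOver` — at `archGenuine 𝔄` (`LogFrobeniusLogWallArchOrigin.lean`: `ℰ• := EA`, `𝒩_v := 𝒞^hol_TH`,
  `𝒩_v → ℰ•` the structure functor `(𝕏 ↶ M) ↦ 𝕏`, archimedean `ι⊞` = abc-iut-L4-t2's `ι_×` (`exp`), the natural inclusion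
  `k^× ↪ k`, the identity `k~ → k~`): each of these morphisms of `𝒞^hol_TH` has base component THE IDENTITY of the
  underlying Aut-holomorphic space `𝕏`, i.e. lies over `EA` — exactly print's "lie over" clause at the genuine
  archimedean model; the nonarchimedean components of that setting are placeholders (identities), over the base trivially;
* `nonarchGenuine_iotaOver` — at `nonarchGenuine p` (`LogFrobeniusLogWallNonarchModel.lean`: `𝒩_v := 𝒳 × 𝒞_TS` = base ×
  local `TS`-pairs of abc-iut-L4-t9's MLF model, `𝒩_v → ℰ• = 𝒳` the first projection, `ι⊞_{v,ε} := (𝟙, ι_ε)`): the first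
  component of `(𝟙, ι_ε)` is the identity of the base — over the base by construction;
* `nonarchGenuineMono_iotaOver` — at `nonarchGenuineMono p` (`LogFrobeniusMonoGenuineModel.lean`, the carrier of the
  LF-ABSTOP F-0138 genuine unit: same holomorphic rows as `nonarchGenuine p`, plus a GENUINE mono-analytic side
  `ℰ⊢ := Up 𝒯𝔾`, which `IotaOver` does not read).

These are the genuine-carrier inputs for the sufficiency direction of Cor 5.5 (i)+(iii)/(v) (abc-iut-f-102: the add-on is
NECESSARY for `RealisesCor55Families`; THEOREM B in progress).  Refereed pre-IUT material; OUR kernel checks over model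
settings; nothing here bears on [IUTchIII] Cor. 3.12; no side taken; instance at a model ≠ the printed theorem for the
printed theaters; typed ≠ proved.
-/

set_option autoImplicit false

noncomputable section

universe u

open CategoryTheory

namespace Literature.AnabelianGeometry.AbsoluteAnabelian

namespace LogFrobeniusSetting

/-! ## The setting with genuine archimedean components -/

section Arch

variable (𝔄 : AutHolFieldFunctor.{u}) (Vmod : Type (u + 1)) (isArc : Vmod → Bool)

/-- Per-Boolean form of `archGenuine_iotaOver`: for `b = true` the three genuine archimedean arrows, for `b = false` the
placeholder identities; in all cases, at each object, both sides are composites of identities of the underlying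
Aut-holomorphic space `𝕏` (the base components of `ι_×`, of `k^× ↪ k` and of the identity arrow are `𝟙 𝕏`; every
structure isomorphism of the setting is an identity). [cite: MochizukiAbsTopIII2015, Def 5.4 (vii) p. 128] -/
private theorem archGenuine_iotaOver_aux (b : Bool) {ν₁ ν₂ : LogVertex b} (ε : LogEdge b ν₁ ν₂) :
    Functor.whiskerRight (archIota 𝔄 b ε) (𝟭 (Up (HolTHPair 𝔄)) ⋙ Up.liftF (HolTHPair.toEA 𝔄)) =
      (Functor.associator _ _ _ ≪≫ Functor.isoWhiskerLeft _ (archLamOver 𝔄 b ν₁) ≪≫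
          (archGenuine 𝔄 Vmod isArc).twistOver ν₁.isPostLog).hom ≫
        (archLamOver 𝔄 b ν₂).inv := by
  ext X₀
  cases b
  · -- nonarchimedean place of THIS setting: placeholder identities
    cases ν₁ <;>
    · change (𝟙 (X₀.down.X) ≫ 𝟙 (X₀.down.X) : X₀.down.X ⟶ X₀.down.X) =
          (𝟙 (X₀.down.X) ≫ (𝟙 (X₀.down.X) ≫ 𝟙 (X₀.down.X))) ≫ 𝟙 (X₀.down.X)
      simp
  · -- archimedean place: `k~ →(id) k~`, `k~ ↠ k^×` (`ι_×`), `k^× ↪ k`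
    cases ε <;>
    · change (𝟙 (X₀.down.X) ≫ 𝟙 (X₀.down.X) : X₀.down.X ⟶ X₀.down.X) =
          (𝟙 (X₀.down.X) ≫ (𝟙 (X₀.down.X) ≫ 𝟙 (X₀.down.X))) ≫ 𝟙 (X₀.down.X)
      simp

/-- **`IotaOver` HOLDS at the setting with genuine archimedean components**: the `ι⊞_{v,ε}` of abc-iut-w4-d095's
`archGenuine 𝔄` — at archimedean `v` abc-iut-L4-t2's `ι_×` (`exp_k`), the natural inclusion `k^× ↪ k` and the identity
`k~ → k~` of Def 5.4 (v), whose base components in `EA` are identities; at nonarchimedean `v` placeholder identities —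
lie over `Th•[Z] = EA`. [cite: MochizukiAbsTopIII2015, Def 5.4 (vii) p. 128] -/
theorem archGenuine_iotaOver : (archGenuine 𝔄 Vmod isArc).IotaOver :=
  fun v _ _ ε => archGenuine_iotaOver_aux 𝔄 Vmod isArc (isArc v) ε

end Arch

/-! ## The setting with genuine nonarchimedean components -/

section Nonarch

open AbsTopIII

variable (p : ℕ) [Fact p.Prime] (Vmod : Type 1) (isArc : Vmod → Bool)

/-- Per-Boolean form of `nonarchGenuine_iotaOver`: `ι⊞_{v,ε} = (𝟙, ι_ε)` at a nonarchimedean place (genuine), the identity at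
an archimedean place of THIS setting (placeholder); the image under the first projection `𝒩_v = 𝒳 × 𝒞_TS → 𝒳 = ℰ•` is,
at each object, a composite of identities of the underlying `TF`-pair, as is the composite of the (identity) structure
isomorphisms. [cite: MochizukiAbsTopIII2015, Def 5.4 (vii) p. 128] -/
private theorem nonarchGenuine_iotaOver_aux (b : Bool) {ν₁ ν₂ : LogVertex b} (ε : LogEdge b ν₁ ν₂) :
    Functor.whiskerRight (nonarchIota p b ε)
        (𝟭 (Up (TFModel p × TSObj)) ⋙ Up.liftF (CategoryTheory.Prod.fst (TFModel p) TSObj)) =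
      (Functor.associator _ _ _ ≪≫ Functor.isoWhiskerLeft _ (nonarchLamOver p b ν₁) ≪≫
          (nonarchGenuine p Vmod isArc).twistOver ν₁.isPostLog).hom ≫
        (nonarchLamOver p b ν₂).inv := by
  ext X₀
  cases b
  · -- nonarchimedean place: `(𝟙, ι_ε)` for the five edges of `Γ⃗^⋉_non`
    cases ν₁ <;>
    · change (𝟙 X₀.down ≫ 𝟙 X₀.down : X₀.down ⟶ X₀.down) =
          (𝟙 X₀.down ≫ (𝟙 X₀.down ≫ 𝟙 X₀.down)) ≫ 𝟙 X₀.down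
      simp
  · -- archimedean place of THIS setting: placeholder identities
    cases ν₁ <;>
    · change (𝟙 X₀.down ≫ 𝟙 X₀.down : X₀.down ⟶ X₀.down) =
          (𝟙 X₀.down ≫ (𝟙 X₀.down ≫ 𝟙 X₀.down)) ≫ 𝟙 X₀.down
      simp

/-- **`IotaOver` HOLDS at the setting with genuine nonarchimedean components**: the `ι⊞_{v,ε} = (𝟙, ι_ε)` of
abc-iut-w4-d095's `nonarchGenuine p` (base × local `TS`-pairs over abc-iut-L4-t9's MLF model; `ι_ε` = the genuine arrows
of Def 5.4 (iii), shell-arrow = the `p`-adic logarithm) lie over `Th•[Z] = 𝒳`: their first components are identities.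
[cite: MochizukiAbsTopIII2015, Def 5.4 (vii) p. 128] -/
theorem nonarchGenuine_iotaOver : (nonarchGenuine p Vmod isArc).IotaOver :=
  fun v _ _ ε => nonarchGenuine_iotaOver_aux p Vmod isArc (isArc v) ε

end Nonarch

/-! ## The setting with genuine nonarchimedean AND genuine mono-analytic components -/

section NonarchMono

open AbsTopIII

variable (p : ℕ) [Fact p.Prime] (Vmod : Type 1) (isArc : Vmod → Bool)

/-- Per-Boolean form at `nonarchGenuineMono` (same holomorphic rows as `nonarchGenuine`; the mono-analytic side, genuine
here, is not read by `IotaOver`). [cite: MochizukiAbsTopIII2015, Def 5.4 (vii) p. 128] -/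
private theorem nonarchGenuineMono_iotaOver_aux (b : Bool) {ν₁ ν₂ : LogVertex b} (ε : LogEdge b ν₁ ν₂) :
    Functor.whiskerRight (nonarchIota p b ε)
        (𝟭 (Up (TFModel p × TSObj)) ⋙ Up.liftF (CategoryTheory.Prod.fst (TFModel p) TSObj)) =
      (Functor.associator _ _ _ ≪≫ Functor.isoWhiskerLeft _ (nonarchLamOver p b ν₁) ≪≫
          (nonarchGenuineMono p Vmod isArc).twistOver ν₁.isPostLog).hom ≫
        (nonarchLamOver p b ν₂).inv := by
  ext X₀
  cases b
  · cases ν₁ <;>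
    · change (𝟙 X₀.down ≫ 𝟙 X₀.down : X₀.down ⟶ X₀.down) =
          (𝟙 X₀.down ≫ (𝟙 X₀.down ≫ 𝟙 X₀.down)) ≫ 𝟙 X₀.down
      simp
  · cases ν₁ <;>
    · change (𝟙 X₀.down ≫ 𝟙 X₀.down : X₀.down ⟶ X₀.down) =
          (𝟙 X₀.down ≫ (𝟙 X₀.down ≫ 𝟙 X₀.down)) ≫ 𝟙 X₀.down
      simp

/-- **`IotaOver` HOLDS at the setting with genuine nonarchimedean and genuine mono-analytic components**
(abc-iut-w4-d095's `nonarchGenuineMono p`, the carrier of the LF-ABSTOP F-0138 genuine unit: `ℰ⊢ := Up 𝒯𝔾`, `W ↦ G_w`):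
its holomorphic rows are those of `nonarchGenuine p`, so the `ι⊞_{v,ε} = (𝟙, ι_ε)` lie over `Th•[Z] = 𝒳` for the same
reason. [cite: MochizukiAbsTopIII2015, Def 5.4 (vii) p. 128] -/
theorem nonarchGenuineMono_iotaOver : (nonarchGenuineMono p Vmod isArc).IotaOver :=
  fun v _ _ ε => nonarchGenuineMono_iotaOver_aux p Vmod isArc (isArc v) ε

end NonarchMono

/-! ## The `TS`-valued `ι_{v,ε}` lie over `Th•[Z]` at the same settings (appended) -/

section ArchTS

variable (𝔄 : AutHolFieldFunctor.{u}) (Vmod : Type (u + 1)) (isArc : Vmod → Bool)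

/-- Per-Boolean form of `archGenuineTS_iotaOverTS` (all edges of `Γ⃗^log_v`; base components identities).
[cite: MochizukiAbsTopIII2015, Def 5.4 (vii) p. 128] -/
private theorem archGenuineTS_iotaOverTS_aux (b : Bool) {ν₁ ν₂ : LogVertex b} (ε : LogEdgeTS b ν₁ ν₂) :
    Functor.whiskerRight (archIotaTS 𝔄 b ε) (Up.liftF (HolTHPair.toEA 𝔄)) =
      (Functor.associator _ _ _).hom ≫
        (Functor.associator _ _ _ ≪≫ Functor.isoWhiskerLeft _ (archLamOver 𝔄 b ν₁) ≪≫
            (archGenuine 𝔄 Vmod isArc).twistOver ν₁.isPostLog).hom ≫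
          (archLamOver 𝔄 b ν₂).inv ≫ (Functor.associator _ _ _).inv := by
  ext X₀
  cases b
  · cases ν₁ <;>
    · change (𝟙 (X₀.down.X) ≫ 𝟙 (X₀.down.X) : X₀.down.X ⟶ X₀.down.X) =
          𝟙 (X₀.down.X) ≫ ((𝟙 (X₀.down.X) ≫ (𝟙 (X₀.down.X) ≫ 𝟙 (X₀.down.X))) ≫
            (𝟙 (X₀.down.X) ≫ 𝟙 (X₀.down.X)))
      simp
  · cases ε <;>
    · change (𝟙 (X₀.down.X) ≫ 𝟙 (X₀.down.X) : X₀.down.X ⟶ X₀.down.X) =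
          𝟙 (X₀.down.X) ≫ ((𝟙 (X₀.down.X) ≫ (𝟙 (X₀.down.X) ≫ 𝟙 (X₀.down.X))) ≫
            (𝟙 (X₀.down.X) ≫ 𝟙 (X₀.down.X)))
      simp

/-- **`IotaOverTS` HOLDS for the `TS`-valued homotopy datum `archGenuineTS` of the setting with genuine archimedean
components** (all three arrows of `Γ⃗^log_arc` = Def 5.4 (v); placeholders at nonarchimedean places): the `ι_{v,ε}` lie over
`Th•[Z] = EA`. [cite: MochizukiAbsTopIII2015, Def 5.4 (vii) p. 128] -/
theorem archGenuineTS_iotaOverTS : (archGenuineTS 𝔄 Vmod isArc).IotaOverTS :=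
  fun v _ _ ε => archGenuineTS_iotaOverTS_aux 𝔄 Vmod isArc (isArc v) ε

end ArchTS

section NonarchTS

open AbsTopIII

variable (p : ℕ) [Fact p.Prime] (Vmod : Type 1) (isArc : Vmod → Bool)

/-- Per-Boolean form of `nonarchGenuineTS_iotaOverTS` (all six arrows of `Γ⃗^log_non`, including the `TS`-only `k̄^× ↪ k̄`;
first components identities). [cite: MochizukiAbsTopIII2015, Def 5.4 (vii) p. 128] -/
private theorem nonarchGenuineTS_iotaOverTS_aux (b : Bool) {ν₁ ν₂ : LogVertex b} (ε : LogEdgeTS b ν₁ ν₂) :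
    Functor.whiskerRight (nonarchIotaTS p b ε) (Up.liftF (CategoryTheory.Prod.fst (TFModel p) TSObj)) =
      (Functor.associator _ _ _).hom ≫
        (Functor.associator _ _ _ ≪≫ Functor.isoWhiskerLeft _ (nonarchLamOver p b ν₁) ≪≫
            (nonarchGenuine p Vmod isArc).twistOver ν₁.isPostLog).hom ≫
          (nonarchLamOver p b ν₂).inv ≫ (Functor.associator _ _ _).inv := by
  ext X₀
  cases b
  · cases ν₁ <;>
    · change (𝟙 X₀.down ≫ 𝟙 X₀.down : X₀.down ⟶ X₀.down) =
          𝟙 X₀.down ≫ ((𝟙 X₀.down ≫ (𝟙 X₀.down ≫ 𝟙 X₀.down)) ≫ (𝟙 X₀.down ≫ 𝟙 X₀.down))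
      simp
  · cases ν₁ <;>
    · change (𝟙 X₀.down ≫ 𝟙 X₀.down : X₀.down ⟶ X₀.down) =
          𝟙 X₀.down ≫ ((𝟙 X₀.down ≫ (𝟙 X₀.down ≫ 𝟙 X₀.down)) ≫ (𝟙 X₀.down ≫ 𝟙 X₀.down))
      simp

/-- **`IotaOverTS` HOLDS for `nonarchGenuineTS`** (all six `TS`-valued arrows of Def 5.4 (iii) at the MLF model, `(𝟙, ι_ε)`):
the `ι_{v,ε}` lie over `Th•[Z] = 𝒳`. [cite: MochizukiAbsTopIII2015, Def 5.4 (vii) p. 128] -/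
theorem nonarchGenuineTS_iotaOverTS : (nonarchGenuineTS p Vmod isArc).IotaOverTS :=
  fun v _ _ ε => nonarchGenuineTS_iotaOverTS_aux p Vmod isArc (isArc v) ε

/-- Per-Boolean form at `nonarchGenuineMonoTS` (same `TS` datum as `nonarchGenuineTS`). [cite: MochizukiAbsTopIII2015, Def 5.4 (vii) p. 128] -/
private theorem nonarchGenuineMonoTS_iotaOverTS_aux (b : Bool) {ν₁ ν₂ : LogVertex b} (ε : LogEdgeTS b ν₁ ν₂) :
    Functor.whiskerRight (nonarchIotaTS p b ε) (Up.liftF (CategoryTheory.Prod.fst (TFModel p) TSObj)) =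
      (Functor.associator _ _ _).hom ≫
        (Functor.associator _ _ _ ≪≫ Functor.isoWhiskerLeft _ (nonarchLamOver p b ν₁) ≪≫
            (nonarchGenuineMono p Vmod isArc).twistOver ν₁.isPostLog).hom ≫
          (nonarchLamOver p b ν₂).inv ≫ (Functor.associator _ _ _).inv := by
  ext X₀
  cases b
  · cases ν₁ <;>
    · change (𝟙 X₀.down ≫ 𝟙 X₀.down : X₀.down ⟶ X₀.down) =
          𝟙 X₀.down ≫ ((𝟙 X₀.down ≫ (𝟙 X₀.down ≫ 𝟙 X₀.down)) ≫ (𝟙 X₀.down ≫ 𝟙 X₀.down))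
      simp
  · cases ν₁ <;>
    · change (𝟙 X₀.down ≫ 𝟙 X₀.down : X₀.down ⟶ X₀.down) =
          𝟙 X₀.down ≫ ((𝟙 X₀.down ≫ (𝟙 X₀.down ≫ 𝟙 X₀.down)) ≫ (𝟙 X₀.down ≫ 𝟙 X₀.down))
      simp

/-- **`IotaOverTS` HOLDS for `nonarchGenuineMonoTS`** (the `TS` datum of the F-0138 genuine carrier).
[cite: MochizukiAbsTopIII2015, Def 5.4 (vii) p. 128] -/
theorem nonarchGenuineMonoTS_iotaOverTS : (nonarchGenuineMonoTS p Vmod isArc).IotaOverTS :=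
  fun v _ _ ε => nonarchGenuineMonoTS_iotaOverTS_aux p Vmod isArc (isArc v) ε

end NonarchTS



end LogFrobeniusSetting

end Literature.AnabelianGeometry.AbsoluteAnabelian
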